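import Literature.Computability.Complexity.YatesMachineZeta
import HarnessLib

/-!
# The evaluation machine of Williams' Lemma 4.2, IV: reading the symmetric gate by sorting

Literature / circuit complexity, continuing `YatesMachineZeta.lean`. After Phase 4 the table
`g = gTable S n` (entry `T` = number of terms true at the `T`-th assignment) sits on `L` as
`2ⁿ` words of width `b`; the truth-table bit of `T` is `S.sym (g T)`, the value of the
symmetric gate, tabulated in the input as the items of `0, …, s`. A machine without random
access reads a table "by value" through two sorts (Williams 2014, App. C): attach to every
point its count, sort points and table entries together by value, sweep once carrying the
current table bit, sort back by point.

* specification: the records `gRec` (`1 :: count ++ point`), `tRec` (`0 :: value ++ [bit]`),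
  `recIn`, **`radixIter_recIn`** (sorting by the `b + 1` low bits puts every cube record right
  behind the gate record of its count: `recSorted`, via the stability theorem
  `radixIter_eq_flatMap_filter`; needs `s < 2ᵇ` and `count ≤ s`, `gVal_le`), the join model
  `joinStep`/`joinFold` with **`joinFold_recSorted`** (every point gets the bit of its count),
  and **`radixIter_joined`** (sorting the joined records by their `n` low bits restores the
  order of the points: `(range 2ⁿ).map (outRec S)`, `outRec S T = point ++ [S.sym (g T)]`);
* machine: `zipBody`/`runs_zipPass` (cube records from `L` and the kept enumeration `Ek`),
  `tauBody`/`runs_tauPass` (gate records from the input items, a `b`-bit counter),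
  `joinBody`/`runs_joinPass`, and `joinProg` / **`runs_joinProg`**: `L := encList` of the
  output records in the order of the points, within `joinCost n b s = O((2ⁿ + s)(n + b) b)`
  steps.

## References

* R. Williams, *Nonuniform ACC circuit lower bounds*, J. ACM 61(1) (2014) 2:1–2:32, Lemma 4.2
  and App. C ("sort … by the value", the multitape implementation of table look-ups)
  [Williams2014].
* D. E. Knuth, *The Art of Computer Programming*, Vol. 3, 2nd ed., 1998, §5.2.5.
-/

namespace Literature.Computability.Complexity

open SProg Com _root_.Computability Finset MetaComplexity

namespace YatesM

open RRF YRF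

variable {n : ℕ}

/-! ### Specification: the records and their two sorts -/

/-- Entry `T` of the final table. [folklore] -/
def gVal (S : SymPlus n) (T : ℕ) : ℕ := (gTable S n).getD T 0

/-- The record of the cube point `T`: tag `1`, the `b`-bit count, the `n`-bit point. [folklore] -/
def gRec (S : SymPlus n) (b T : ℕ) : List Bool := true :: (natToWord b (gVal S T) ++ natToWord n T)

/-- The record of the value `v` of the symmetric gate: tag `0`, the `b`-bit value, the bit
`S.sym v`. [folklore] -/
def tRec (S : SymPlus n) (b v : ℕ) : List Bool := false :: (natToWord b v ++ [S.sym v])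

/-- The records handed to the first sort: cube records, then gate records. [folklore] -/
def recIn (S : SymPlus n) (b : ℕ) : List (List Bool) :=
  (List.range (2 ^ n)).map (gRec S b) ++ (List.range (S.size + 1)).map (tRec S b)

/-- The cube points with count `v`, in increasing order. [folklore] -/
def ptsOf (S : SymPlus n) (v : ℕ) : List ℕ := (List.range (2 ^ n)).filter fun T => decide (gVal S T = v)

/-- The sorted records: for each value `v ≤ s`, the gate record of `v`, then the cube records
of count `v`. [folklore] -/
def recSorted (S : SymPlus n) (b : ℕ) : List (List Bool) :=
  (List.range (S.size + 1)).flatMap fun v => tRec S b v :: (ptsOf S v).map (gRec S b)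

/-- Low bits of a tagged record: the tag and the `b`-bit field. [folklore] -/
theorem lowBits_cons_append (tg : Bool) (b v : ℕ) (rest : List Bool) (hv : v < 2 ^ b) :
    lowBits (b + 1) (tg :: (natToWord b v ++ rest)) = tg.toNat + 2 * v := by
  rw [lowBits, List.take_succ_cons, List.take_append_of_le_length (by simp), List.take_of_length_le (by simp),
    bitsToNat_cons, bitsToNat_natToWord_of_lt hv]

/-- Counts are at most `s`. [folklore] -/
theorem gVal_le (S : SymPlus n) (T : ℕ) : gVal S T ≤ S.size := getD_gTable_le S n T

/-- **The first sort groups every cube record behind the gate record of its count**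
(`s < 2ᵇ`). [folklore] -/
theorem radixIter_recIn (S : SymPlus n) {b : ℕ} (hb : S.size < 2 ^ b) :
    radixIter (recIn S b) (b + 1) = recSorted S b := by
  rw [radixIter_eq_flatMap_filter, pow_succ', flatMap_range_two_mul, recSorted]
  -- values beyond `s` contribute nothing
  have hsplit : List.range (2 ^ b) = List.range (S.size + 1) ++ (List.range (2 ^ b - (S.size + 1))).map (S.size + 1 + ·) := by
    rw [← List.range_add, Nat.add_sub_cancel' hb]
  have hkeyG : ∀ T, lowBits (b + 1) (gRec S b T) = 1 + 2 * gVal S T := fun T =>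
    lowBits_cons_append true b _ _ ((gVal_le S T).trans_lt hb)
  have hkeyT : ∀ v, v ≤ S.size → lowBits (b + 1) (tRec S b v) = 2 * v := fun v hv => by
    rw [tRec, lowBits_cons_append false b _ _ (lt_of_le_of_lt hv hb)]; simp
  have hgroup : ∀ v, (recIn S b).filter (fun w => decide (lowBits (b + 1) w = 2 * v)) ++
      (recIn S b).filter (fun w => decide (lowBits (b + 1) w = 2 * v + 1)) =
      if v ≤ S.size then tRec S b v :: (ptsOf S v).map (gRec S b) else [] := by
    intro v
    simp only [recIn, List.filter_append, List.filter_map]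
    have e1 : (List.range (2 ^ n)).filter ((fun w => decide (lowBits (b + 1) w = 2 * v)) ∘ gRec S b) = [] := by
      rw [List.filter_eq_nil_iff]; intro T _; simp [hkeyG]; omega
    have e2 : (List.range (S.size + 1)).filter ((fun w => decide (lowBits (b + 1) w = 2 * v + 1)) ∘ tRec S b) = [] := by
      rw [List.filter_eq_nil_iff]; intro u hu; rw [List.mem_range] at hu
      simp [hkeyT u (by omega)]; omega
    have e3 : (List.range (2 ^ n)).filter ((fun w => decide (lowBits (b + 1) w = 2 * v + 1)) ∘ gRec S b) = ptsOf S v := by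
      unfold ptsOf; refine List.filter_congr fun T _ => ?_
      simp only [Function.comp_apply, hkeyG, decide_eq_decide]; omega
    have e4 : (List.range (S.size + 1)).filter ((fun w => decide (lowBits (b + 1) w = 2 * v)) ∘ tRec S b) =
        if v ≤ S.size then [v] else [] := by
      have : (List.range (S.size + 1)).filter ((fun w => decide (lowBits (b + 1) w = 2 * v)) ∘ tRec S b) =
          (List.range (S.size + 1)).filter (fun u => decide (u = v)) := by
        refine List.filter_congr fun u hu => ?_; rw [List.mem_range] at hu
        simp only [Function.comp_apply, hkeyT u (by omega), decide_eq_decide]; omega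
      rw [this, List.filter_eq, List.count_range]
      by_cases h : v ≤ S.size
      · rw [if_pos (by omega), if_pos h]; rfl
      · rw [if_neg (by omega), if_neg h]; rfl
    rw [e1, e2, e3, e4]
    by_cases h : v ≤ S.size
    · rw [if_pos h, if_pos h]; simp
    · rw [if_neg h, if_neg h]
      have : ptsOf S v = [] := by
        rw [ptsOf, List.filter_eq_nil_iff]; intro T _; have := gVal_le S T; simp; omega
      rw [this]; simp
  rw [hsplit, List.flatMap_append]
  have hhi : ((List.range (2 ^ b - (S.size + 1))).map (S.size + 1 + ·)).flatMap (fun T =>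
      (recIn S b).filter (fun w => decide (lowBits (b + 1) w = 2 * T)) ++
      (recIn S b).filter (fun w => decide (lowBits (b + 1) w = 2 * T + 1))) = [] := by
    rw [List.flatMap_eq_nil_iff]
    intro T hT
    rw [List.mem_map] at hT; obtain ⟨u, -, rfl⟩ := hT
    rw [hgroup, if_neg (by omega)]
  rw [hhi, List.append_nil]
  refine List.flatMap_congr fun v hv => ?_
  rw [List.mem_range] at hv
  rw [hgroup, if_pos (by omega)]

/-! ### Specification: the join pass and the second sort -/

/-- One step of the join pass: a gate record (tag `0`) sets the current bit to its last bit, a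
cube record (tag `1`) emits its point followed by the current bit. [folklore] -/
def joinStep (b : ℕ) (st : Bool × List (List Bool)) (w : List Bool) : Bool × List (List Bool) :=
  match w with
  | false :: rest => ((rest.drop b).headD false, st.2)
  | true :: rest => (st.1, st.2 ++ [rest.drop b ++ [st.1]])
  | [] => st

/-- The join pass as a fold. [folklore] -/
def joinFold (b : ℕ) (l : List (List Bool)) (st : Bool × List (List Bool)) : Bool × List (List Bool) :=
  l.foldl (joinStep b) st

/-- The output record of the point `T`: its `n` bits, then its truth-table bit. [folklore] -/
def outRec (S : SymPlus n) (T : ℕ) : List Bool := natToWord n T ++ [S.sym (gVal S T)]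

/-- **The join pass attaches to every cube point the gate bit of its count.** [folklore] -/
theorem joinFold_recSorted (S : SymPlus n) (b : ℕ) (x : Bool) :
    (joinFold b (recSorted S b) (x, [])).2 =
      (List.range (S.size + 1)).flatMap fun v => (ptsOf S v).map (outRec S) := by
  suffices H : ∀ (Vs : List ℕ) (x : Bool) (E : List (List Bool)),
      (joinFold b (Vs.flatMap fun v => tRec S b v :: (ptsOf S v).map (gRec S b)) (x, E)).2 =
        E ++ Vs.flatMap fun v => (ptsOf S v).map (outRec S) by
    have := H (List.range (S.size + 1)) x []
    rw [List.nil_append] at this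
    exact this
  intro Vs
  induction Vs with
  | nil => intro x E; simp [joinFold]
  | cons v Vs ih =>
    intro x E
    rw [List.flatMap_cons, List.cons_append, joinFold, List.foldl_cons, List.foldl_append]
    have hτ : joinStep b (x, E) (tRec S b v) = (S.sym v, E) := by
      simp [joinStep, tRec]
    rw [hτ]
    have hG : ∀ (pts : List ℕ) (E : List (List Bool)), (∀ T ∈ pts, gVal S T = v) →
        List.foldl (joinStep b) (S.sym v, E) (pts.map (gRec S b)) = (S.sym v, E ++ pts.map (outRec S)) := by
      intro pts
      induction pts with
      | nil => intro E _; simp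
      | cons T pts ih' =>
        intro E hpts
        rw [List.map_cons, List.foldl_cons, show joinStep b (S.sym v, E) (gRec S b T) = (S.sym v, E ++ [outRec S T]) by
          simp [joinStep, gRec, outRec, hpts T (by simp)],
          ih' _ (fun T' hT' => hpts T' (by simp [hT']))]
        simp
    rw [hG _ _ (fun T hT => by simp [ptsOf] at hT; exact hT.2)]
    have := ih (S.sym v) (E ++ (ptsOf S v).map (outRec S))
    rw [joinFold] at this
    rw [this, List.flatMap_cons, List.append_assoc]

/-- The joined records: the output records grouped by count. [folklore] -/
def joined (S : SymPlus n) : List (List Bool) :=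
  (List.range (S.size + 1)).flatMap fun v => (ptsOf S v).map (outRec S)

/-- A flat map selecting one index yields a singleton. [folklore] -/
theorem flatMap_ite_singleton {α : Type} (m a : ℕ) (x : List α) (ha : a < m) :
    (List.range m).flatMap (fun v => if a = v then x else []) = x := by
  induction m with
  | zero => omega
  | succ m ih =>
    rw [List.range_succ, List.flatMap_append, List.flatMap_singleton]
    rcases Nat.lt_succ_iff_lt_or_eq.1 ha with h | rfl
    · rw [ih h, if_neg (by omega), List.append_nil]
    · rw [if_pos rfl]
      have : (List.range a).flatMap (fun v => if a = v then x else []) = [] := by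
        rw [List.flatMap_eq_nil_iff]; intro v hv; rw [List.mem_range] at hv; rw [if_neg (by omega)]
      rw [this, List.nil_append]

/-- **The second sort restores the order of the points**: every point occurs in exactly one
group, and its record carries the point in its `n` low bits. [folklore] -/
theorem radixIter_joined (S : SymPlus n) : radixIter (joined S) n = (List.range (2 ^ n)).map (outRec S) := by
  rw [radixIter_eq_flatMap_filter, show (List.range (2 ^ n)).map (outRec S) =
    (List.range (2 ^ n)).flatMap (fun u => [outRec S u]) by rw [← List.flatMap_singleton' ((List.range (2 ^ n)).map _),
      List.flatMap_map]]
  refine List.flatMap_congr fun u hu => ?_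
  rw [List.mem_range] at hu
  have hkey : ∀ T, T < 2 ^ n → lowBits n (outRec S T) = T := fun T hT => by
    rw [outRec, lowBits, List.take_append_of_le_length (by simp), List.take_of_length_le (by simp),
      bitsToNat_natToWord_of_lt hT]
  rw [joined, List.filter_flatMap]
  have hinner : ∀ v, ((ptsOf S v).map (outRec S)).filter (fun w => decide (lowBits n w = u)) =
      if gVal S u = v then [outRec S u] else [] := by
    intro v
    rw [List.filter_map]
    have : (ptsOf S v).filter ((fun w => decide (lowBits n w = u)) ∘ outRec S) =
        (ptsOf S v).filter (fun T => decide (T = u)) := by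
      refine List.filter_congr fun T hT => ?_
      simp only [ptsOf, List.mem_filter, List.mem_range] at hT
      simp only [Function.comp_apply, hkey T hT.1]
    rw [this, List.filter_eq]
    by_cases h : gVal S u = v
    · have hc : (ptsOf S v).count u = 1 := by
        rw [ptsOf, List.count_filter (by simp [h]), List.count_range, if_pos hu]
      rw [if_pos h, hc]; rfl
    · rw [if_neg h]
      have : (ptsOf S v).count u = 0 := by
        rw [List.count_eq_zero]; simp [ptsOf, h]
      rw [this]; rfl
  simp_rw [hinner]
  exact flatMap_ite_singleton (S.size + 1) (gVal S u) [outRec S u] (Nat.lt_succ_of_le (gVal_le S u))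

/-- The final table as the list of its entries. [folklore] -/
theorem gTable_n_eq_map (S : SymPlus n) : gTable S n = (List.range (2 ^ n)).map (gVal S) := by
  refine List.ext_getElem (by simp) fun i h₁ h₂ => ?_
  rw [List.getElem_map, List.getElem_range, gVal, List.getD_eq_getElem?_getD, List.getElem?_eq_getElem h₁,
    Option.getD_some]

/-! ### Phase 5a: the cube records -/

/-- Emit the tag bit held at the top of `C` (popped). [folklore] -/
def emitTagC : Com YReg := pop oC (push iz true ;; push iz true) (push iz false ;; push iz false) skip

/-- The body of the zip pass: the count word from `L`, the tagged point from `Ek`, emitted as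
one record `1 :: count ++ point`. [folklore] -/
def zipBody : Com YReg :=
  readItemTo iL iA iw it ;; readItemTo oEk oC iw it ;; emitTagC ;; emitPart iA iz ;; emitPart oC iz ;; emitSep iz

/-- Effect of `zipBody`: `15 b + 15 n + 37` steps. [folklore] -/
theorem runs_zipBody {b : ℕ} (g pt rest rest' : List Bool) (ρ : RRF) (σ : YRF)
    (hL : ρ.L = dbl g ++ false :: true :: rest) (hEk : σ.Ek = dbl (true :: pt) ++ false :: true :: rest')
    (hg : g.length = b) (hpt : pt.length = n) (hA : ρ.A = []) (hw : ρ.w = []) (ht : ρ.t = []) (hC : σ.C = []) :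
    Runs zipBody (est ρ σ) (est { ρ with L := rest, z := true :: false :: ((dbl (true :: (g ++ pt))).reverse ++ ρ.z) }
      { σ with Ek := rest' }) (15 * b + 15 * n + 37) := by
  set ρ₁ : RRF := { ρ with L := rest, A := g } with hρ₁
  have h1 : Runs (readItemTo iL iA iw it) (est ρ σ) (est ρ₁ σ) (11 * b + 9) := by
    have h := runs_readItemTo (L := iL) (A := iA) (w := iw) (t := it) (by decide) (by decide) (by decide)
      (by decide) (by decide) g rest (est ρ σ) (by simp [hL]) (by simp [hw]) (by simp [ht])
    rw [hg] at h
    refine h.of_eq ?_ le_rfl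
    simp only [hρ₁]; simp [hA]
  set σ₂ : YRF := { σ with Ek := rest', C := true :: pt } with hσ₂
  have h2 : Runs (readItemTo oEk oC iw it) (est ρ₁ σ) (est ρ₁ σ₂) (11 * (n + 1) + 9) := by
    have h := runs_readItemTo (L := oEk) (A := oC) (w := iw) (t := it) (by decide) (by decide) (by decide)
      (by decide) (by decide) (true :: pt) rest' (est ρ₁ σ) (by simp [hEk]) (by simp [hρ₁, hw]) (by simp [hρ₁, ht])
    rw [List.length_cons, hpt] at h
    refine h.of_eq ?_ le_rfl
    simp only [hσ₂, hρ₁]; simp [hC]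
  set σ₃ : YRF := { σ₂ with C := pt } with hσ₃
  set ρ₃ : RRF := { ρ₁ with z := true :: true :: ρ.z } with hρ₃
  have h3 : Runs emitTagC (est ρ₁ σ₂) (est ρ₃ σ₃) 4 := by
    refine (Runs.pop_true _ _ (w := pt) (by simp [hσ₂]) ((Runs.push iz true _).seq (Runs.push iz true _))).of_eq ?_ (by rfl)
    simp only [hρ₃, hρ₁, hσ₃, hσ₂]; simp
  set ρ₄ : RRF := { ρ₃ with A := [], z := (dbl g).reverse ++ (true :: true :: ρ.z) } with hρ₄
  have h4 : Runs (emitPart iA iz) (est ρ₃ σ₃) (est ρ₄ σ₃) (4 * b + 1) := by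
    have h := runs_emitPart (h := iA) (o := iz) (by decide) (est ρ₃ σ₃)
    rw [show (est ρ₃ σ₃ iA).length = b by simp [hρ₃, hρ₁, hg]] at h
    refine h.of_eq ?_ le_rfl
    simp only [hρ₄, hρ₃, hρ₁]; simp
  set ρ₅ : RRF := { ρ₄ with z := (dbl pt).reverse ++ ((dbl g).reverse ++ (true :: true :: ρ.z)) } with hρ₅
  set σ₅ : YRF := { σ₃ with C := [] } with hσ₅
  have h5 : Runs (emitPart oC iz) (est ρ₄ σ₃) (est ρ₅ σ₅) (4 * n + 1) := by
    have h := runs_emitPart (h := oC) (o := iz) (by decide) (est ρ₄ σ₃)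
    rw [show (est ρ₄ σ₃ oC).length = n by simp [hσ₃, hpt]] at h
    refine h.of_eq ?_ le_rfl
    simp only [hρ₅, hρ₄, hρ₃, hρ₁, hσ₅, hσ₃, hσ₂]; simp
  have h6 := runs_emitSep iz (est ρ₅ σ₅)
  refine (h1.seq (h2.seq (h3.seq (h4.seq (h5.seq h6))))).of_eq ?_ (by omega)
  simp only [hρ₅, hρ₄, hρ₃, hρ₁, hσ₅, hσ₃, hσ₂, update_est_inl, update_z, Sum.elim_inl, regs_z, hA]
  obtain ⟨⟩ := σ; simp only at hC ⊢; simp [hC, dbl, List.reverse_append]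

/-- The count word and the tagged point of `T`. [folklore] -/
def gw (S : SymPlus n) (b T : ℕ) : List Bool := natToWord b (gVal S T)

/-- **The zip pass**: over the points `Ts` still to do, the records `gRec` are emitted in order.
[folklore] -/
theorem runs_zipPass (S : SymPlus n) (b : ℕ) (Ts : List ℕ) (ρ : RRF) (σ : YRF)
    (hL : ρ.L = encList (Ts.map (gw S b))) (hEk : σ.Ek = encList (Ts.map fun T => true :: natToWord n T))
    (hA : ρ.A = []) (hz : ρ.z = []) (hw : ρ.w = []) (ht : ρ.t = []) (hC : σ.C = []) :
    Runs (streamLoop iL iw zipBody) (est ρ σ)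
      (est { ρ with L := [], z := outRev (Ts.map (gRec S b)) } { σ with Ek := [] })
      ((Ts.map fun _ => 15 * b + 15 * n + 37).sum + 6 * Ts.length + 4) := by
  let P : List ℕ → Regs YReg → Prop := fun l R => ∃ done, Ts = done ++ l ∧
    R = est { ρ with L := encList (l.map (gw S b)), z := outRev (done.map (gRec S b)) }
      { σ with Ek := encList (l.map fun T => true :: natToWord n T) }
  have hbody : ∀ (a : ℕ) (l : List ℕ) (R : Regs YReg), P (a :: l) R → R iL = encList ((a :: l).map (gw S b)) →
      R iw = [] → ∃ R', Runs zipBody R R' (15 * b + 15 * n + 37) ∧ R' iL = encList (l.map (gw S b)) ∧ R' iw = [] ∧ P l R' := by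
    rintro a l R ⟨done, hdone, rfl⟩ - -
    refine ⟨_, runs_zipBody (b := b) (n := n) (gw S b a) (natToWord n a) (encList (l.map (gw S b)))
      (encList (l.map fun T => true :: natToWord n T)) _ _ (by simp [encList_cons_eq_dbl]) (by simp [encList_cons_eq_dbl])
      (by simp [gw]) (by simp) (by simp [hA]) (by simp [hw]) (by simp [ht]) (by simp [hC]),
      by simp, by simp [hw], done ++ [a], by simp [hdone], ?_⟩
    simp [outRev_append, gRec, gw, dbl]
  obtain ⟨R', hloop, -, -, ⟨done, hdone, rfl⟩⟩ := runs_streamLoop (L := iL) (w := iw) (by decide)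
    (fun l => encList (l.map (gw S b))) rfl (fun a l => by simpa using encList_cons_ne_nil _ _)
    P (fun _ => 15 * b + 15 * n + 37) hbody Ts (est ρ σ)
    ⟨[], by simp, by obtain ⟨⟩ := ρ; obtain ⟨⟩ := σ; simp only at hL hz hEk ⊢; simp [hL, hz, hEk]⟩ (by simp [hL]) (by simp [hw])
  rw [List.append_nil] at hdone
  subst hdone
  exact hloop.of_eq (by simp) le_rfl

/-! ### Phase 5b: the gate records -/

/-- Emit the gate bit: `1` iff the item just read (on `A`, at most one bit) is nonempty. [folklore] -/
def emitBitA : Com YReg :=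
  pop iA (push iz true ;; push iz true) (push iz false ;; push iz false) (push iz false ;; push iz false)

/-- The body of the gate pass: read the next table item (`bin 0 = []` or `bin 1 = [1]`), emit
the record `0 :: counter ++ [bit]`, increment the counter. [folklore] -/
def tauBody : Com YReg :=
  readItem oInp iA iw ;; (push iz false ;; push iz false) ;; copy oAcc oC it ip ;; emitPart oC iz ;; emitBitA ;;
    emitSep iz ;; incrWord oAcc oC iw

/-- The table item of the value `v`. [folklore] -/
def tItem (S : SymPlus n) (v : ℕ) : List Bool := encodeNat (if S.sym v then 1 else 0)

/-- The table item is the bit, if set. [folklore] -/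
theorem tItem_eq (S : SymPlus n) (v : ℕ) : tItem S v = if S.sym v then [true] else [] := by
  unfold tItem; cases S.sym v <;> rfl

/-- Effect of `tauBody` with the counter at `v`: `23 b + 36` steps. [folklore] -/
theorem runs_tauBody (S : SymPlus n) {b : ℕ} (v : ℕ) (rest : List Bool) (ρ : RRF) (σ : YRF)
    (hinp : σ.inp = dbl (tItem S v) ++ false :: true :: rest) (hacc : σ.acc = natToWord b v) (hA : ρ.A = [])
    (hw : ρ.w = []) (ht : ρ.t = []) (hp : ρ.p = []) (hC : σ.C = []) :
    Runs tauBody (est ρ σ) (est { ρ with z := true :: false :: ((dbl (tRec S b v)).reverse ++ ρ.z) }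
      { σ with inp := rest, acc := natToWord b (v + 1) }) (23 * b + 36) := by
  set σ₁ : YRF := { σ with inp := rest } with hσ₁
  set ρ₁ : RRF := { ρ with A := (tItem S v).reverse } with hρ₁
  have h1 : Runs (readItem oInp iA iw) (est ρ σ) (est ρ₁ σ₁) 16 := by
    have h := runs_readItem (L := oInp) (A := iA) (w := iw) (by decide) (by decide) (by decide) (tItem S v) rest
      (est ρ σ) (by simp [hinp]) (by simp [hw])
    refine h.of_eq ?_ ?_
    · simp only [hσ₁, hρ₁]; simp [hA]
    · rw [tItem_eq]; split_ifs <;> simp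
  set ρ₂ : RRF := { ρ₁ with z := false :: false :: ρ.z } with hρ₂
  have h2 : Runs (push iz false ;; push iz false) (est ρ₁ σ₁) (est ρ₂ σ₁) 2 := by
    refine ((Runs.push iz false _).seq (Runs.push iz false _)).of_eq ?_ (by rfl)
    simp only [hρ₂, hρ₁]; simp
  set σ₃ : YRF := { σ₁ with C := natToWord b v } with hσ₃
  have h3 : Runs (copy oAcc oC it ip) (est ρ₂ σ₁) (est ρ₂ σ₃) (10 * b + 3) := by
    have h := runs_copy (a := oAcc) (b := oC) (t := it) (u := ip) (by decide) (by decide) (by decide) (by decide)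
      (by decide) (by decide) (est ρ₂ σ₁) (by simp [hρ₂, hρ₁, ht]) (by simp [hρ₂, hρ₁, hp])
    rw [show (est ρ₂ σ₁ oAcc).length = b by simp [hσ₁, hacc]] at h
    refine h.of_eq ?_ le_rfl
    simp only [hσ₃, hσ₁]; simp [hacc, hC]
  set ρ₄ : RRF := { ρ₂ with z := (dbl (natToWord b v)).reverse ++ (false :: false :: ρ.z) } with hρ₄
  set σ₄ : YRF := { σ₃ with C := [] } with hσ₄
  have h4 : Runs (emitPart oC iz) (est ρ₂ σ₃) (est ρ₄ σ₄) (4 * b + 1) := by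
    have h := runs_emitPart (h := oC) (o := iz) (by decide) (est ρ₂ σ₃)
    rw [show (est ρ₂ σ₃ oC).length = b by simp [hσ₃]] at h
    refine h.of_eq ?_ le_rfl
    simp only [hρ₄, hρ₂, hρ₁, hσ₄, hσ₃]; simp
  set ρ₅ : RRF := { ρ₄ with A := [], z := S.sym v :: S.sym v :: ((dbl (natToWord b v)).reverse ++ (false :: false :: ρ.z)) }
    with hρ₅
  have h5 : Runs emitBitA (est ρ₄ σ₄) (est ρ₅ σ₄) 4 := by
    have hAv : est ρ₄ σ₄ iA = (tItem S v).reverse := by simp [hρ₄, hρ₂, hρ₁]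
    rw [tItem_eq] at hAv
    cases hs : S.sym v with
    | true =>
      rw [hs] at hAv; simp only [if_true, List.reverse_singleton] at hAv
      refine (Runs.pop_true _ _ (w := []) hAv ((Runs.push iz true _).seq (Runs.push iz true _))).of_eq ?_ (by rfl)
      simp only [hρ₅, hρ₄, hρ₂, hρ₁, hs]; simp
    | false =>
      rw [hs] at hAv; simp only [Bool.false_eq_true, if_false, List.reverse_nil] at hAv
      refine (Runs.pop_nil _ _ hAv ((Runs.push iz false _).seq (Runs.push iz false _))).of_eq ?_ (by rfl)
      simp only [hρ₅, hρ₄, hρ₂, hρ₁, hs]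
      obtain ⟨⟩ := ρ; simp only at hA ⊢; simp [tItem_eq, hs]
  set ρ₆ : RRF := { ρ₅ with z := true :: false :: (S.sym v :: S.sym v :: ((dbl (natToWord b v)).reverse ++
    (false :: false :: ρ.z))) } with hρ₆
  have h6 : Runs (emitSep iz) (est ρ₅ σ₄) (est ρ₆ σ₄) 2 := (runs_emitSep iz _).of_eq (by simp only [hρ₆, hρ₅]; simp) le_rfl
  set σ₇ : YRF := { σ₄ with acc := natToWord b (v + 1) } with hσ₇
  have h7 : Runs (incrWord oAcc oC iw) (est ρ₆ σ₄) (est ρ₆ σ₇) (9 * b + 8) := by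
    have h := runs_incrWord (A := oAcc) (T := oC) (w := iw) (by decide) (by decide) (by decide) (est ρ₆ σ₄)
      (by simp [hσ₄]) (by simp [hρ₆, hρ₅, hρ₄, hρ₂, hρ₁, hw])
    rw [show (est ρ₆ σ₄ oAcc).length = b by simp [hσ₄, hσ₃, hσ₁, hacc]] at h
    refine h.of_eq ?_ le_rfl
    simp only [hσ₇, hσ₄, hσ₃, hσ₁]; simp [hacc, incrSpec_natToWord]
  refine (h1.seq (h2.seq (h3.seq (h4.seq (h5.seq (h6.seq h7)))))).of_eq ?_ (by omega)
  simp only [hρ₆, hρ₅, hρ₄, hρ₂, hρ₁, hσ₇, hσ₄, hσ₃, hσ₁, hA]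
  obtain ⟨⟩ := σ; simp only at hC ⊢; simp [hC, tRec, dbl, List.reverse_append]

/-- **The gate pass**: over the values `vs` still to do (the counter at the first of them),
the records `tRec` are emitted in order. [folklore] -/
theorem runs_tauPass (S : SymPlus n) (b : ℕ) : ∀ (vs : List ℕ) (v₀ : ℕ) (E : List (List Bool)) (ρ : RRF) (σ : YRF),
    vs = (List.range vs.length).map (v₀ + ·) → σ.inp = encList (vs.map (tItem S)) → σ.acc = natToWord b v₀ →
    ρ.A = [] → ρ.z = outRev E → ρ.w = [] → ρ.t = [] → ρ.p = [] → σ.C = [] →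
    Runs (streamLoop oInp iw tauBody) (est ρ σ)
      (est { ρ with z := outRev (E ++ vs.map (tRec S b)) } { σ with inp := [], acc := natToWord b (v₀ + vs.length) })
      ((vs.map fun _ => 23 * b + 36).sum + 6 * vs.length + 4) := by
  intro vs v₀ E ρ σ hvs hinp hacc hA hz hw ht hp hC
  let P : List ℕ → Regs YReg → Prop := fun l R => ∃ done, vs = done ++ l ∧
    R = est { ρ with z := outRev (E ++ done.map (tRec S b)) }
      { σ with inp := encList (l.map (tItem S)), acc := natToWord b (v₀ + done.length) }
  have hval : ∀ (done : List ℕ) (a : ℕ) (l : List ℕ), vs = done ++ a :: l → a = v₀ + done.length := by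
    intro done a l h
    have h1 : vs[done.length]? = some a := by rw [h]; simp
    rw [hvs] at h1
    simp only [List.getElem?_map] at h1
    rw [List.getElem?_range (by
      have := congrArg List.length h; simp at this; omega)] at h1
    simpa [eq_comm] using h1
  have hbody : ∀ (a : ℕ) (l : List ℕ) (R : Regs YReg), P (a :: l) R → R oInp = encList ((a :: l).map (tItem S)) →
      R iw = [] → ∃ R', Runs tauBody R R' (23 * b + 36) ∧ R' oInp = encList (l.map (tItem S)) ∧ R' iw = [] ∧ P l R' := by
    rintro a l R ⟨done, hdone, rfl⟩ - -
    have ha := hval done a l hdone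
    refine ⟨_, runs_tauBody S (b := b) a (encList (l.map (tItem S))) _ _ (by simp [encList_cons_eq_dbl])
      (by simp [ha]) (by simp [hA]) (by simp [hw]) (by simp [ht]) (by simp [hp]) (by simp [hC]),
      by simp, by simp [hw], done ++ [a], by simp [hdone], ?_⟩
    simp only [List.map_append, List.map_cons, List.map_nil, ← List.append_assoc, outRev_append]
    simp [dbl, ha, Nat.add_assoc]
  obtain ⟨R', hloop, -, -, ⟨done, hdone, rfl⟩⟩ := runs_streamLoop (L := oInp) (w := iw) (by decide)
    (fun l => encList (l.map (tItem S))) rfl (fun a l => by simpa using encList_cons_ne_nil _ _)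
    P (fun _ => 23 * b + 36) hbody vs (est ρ σ)
    ⟨[], by simp, by obtain ⟨⟩ := ρ; obtain ⟨⟩ := σ; simp only at hz hinp hacc ⊢; simp [hz, hinp, hacc]⟩
    (by simp [hinp]) (by simp [hw])
  rw [List.append_nil] at hdone
  subst hdone
  exact hloop.of_eq (by simp) le_rfl

/-! ### Phase 5c: the join pass -/

/-- Emit the point on `A` followed by the current gate bit (peeked on `X`). [folklore] -/
def emitWithX : Com YReg :=
  emitPart iA iz ;; pop oX (push oX true ;; push iz true ;; push iz true) (push oX false ;; push iz false ;; push iz false)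
    (push iz false ;; push iz false) ;; emitSep iz

/-- The body of the join pass: read a record; a gate record (tag `0`) sets `X` to its last bit,
a cube record (tag `1`) emits its point with the bit on `X`. [folklore] -/
def joinBody : Com YReg :=
  readItemTo iL iA iw it ;;
    pop iA ((dropBits iA oBw iV ;; pour iV oBw) ;; emitWithX)
      ((dropBits iA oBw iV ;; pour iV oBw) ;; clear oX ;; pour iA oX) skip

/-- A uniform bound for the cost of `joinBody`. [folklore] -/
def joinBound (n b : ℕ) : ℕ := 15 * n + 19 * b + 42

/-- Effect of `joinBody` on a gate record. [folklore] -/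
theorem runs_joinBody_tRec (S : SymPlus n) {b : ℕ} (v : ℕ) (rest : List Bool) (x : Bool) (ρ : RRF) (σ : YRF)
    (hL : ρ.L = dbl (tRec S b v) ++ false :: true :: rest) (hA : ρ.A = []) (hw : ρ.w = []) (ht : ρ.t = [])
    (hV : ρ.V = []) (hBw : σ.Bw = List.replicate b true) (hX : σ.X = [x]) :
    Runs joinBody (est ρ σ) (est { ρ with L := rest } { σ with X := [S.sym v] }) (joinBound n b) := by
  set ρ₁ : RRF := { ρ with L := rest, A := tRec S b v } with hρ₁
  have h1 : Runs (readItemTo iL iA iw it) (est ρ σ) (est ρ₁ σ) (11 * (b + 2) + 9) := by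
    have h := runs_readItemTo (L := iL) (A := iA) (w := iw) (t := it) (by decide) (by decide) (by decide)
      (by decide) (by decide) (tRec S b v) rest (est ρ σ) (by simp [hL]) (by simp [hw]) (by simp [ht])
    rw [show (tRec S b v).length = b + 2 by simp [tRec]] at h
    refine h.of_eq ?_ le_rfl
    simp only [hρ₁]; simp [hA]
  set ρ₂ : RRF := { ρ₁ with A := [S.sym v], V := List.replicate b true } with hρ₂
  set σ₂ : YRF := { σ with Bw := [] } with hσ₂
  have h2 : Runs (dropBits iA oBw iV) (Function.update (est ρ₁ σ) iA (natToWord b v ++ [S.sym v])) (est ρ₂ σ₂) (5 * b + 1) := by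
    have h := runs_dropBits (A := iA) (U := oBw) (V := iV) (by decide) (by decide) (by decide) b
      (Function.update (est ρ₁ σ) iA (natToWord b v ++ [S.sym v])) (by simp [hBw])
    refine h.of_eq ?_ le_rfl
    simp only [hρ₂, hρ₁, hσ₂]; simp [hV]
  set σ₃ : YRF := { σ with Bw := List.replicate b true } with hσ₃
  set ρ₃ : RRF := { ρ₂ with V := [] } with hρ₃
  have h3 : Runs (pour iV oBw) (est ρ₂ σ₂) (est ρ₃ σ₃) (3 * b + 1) := by
    have h := runs_pour (a := iV) (b := oBw) (by decide) (est ρ₂ σ₂)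
    rw [show (est ρ₂ σ₂ iV).length = b by simp [hρ₂]] at h
    refine h.of_eq ?_ le_rfl
    simp only [hρ₃, hρ₂, hσ₃, hσ₂]; simp
  set σ₄ : YRF := { σ₃ with X := [] } with hσ₄
  have h4 : Runs (clear oX) (est ρ₃ σ₃) (est ρ₃ σ₄) 3 := by
    have h := runs_clear oX (est ρ₃ σ₃)
    rw [show (est ρ₃ σ₃ oX).length = 1 by simp [hσ₃, hX]] at h
    exact h.of_eq (by simp only [hσ₄, update_est_inr, update_X]) le_rfl
  set σ₅ : YRF := { σ₄ with X := [S.sym v] } with hσ₅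
  set ρ₅ : RRF := { ρ₃ with A := [] } with hρ₅
  have h5 : Runs (pour iA oX) (est ρ₃ σ₄) (est ρ₅ σ₅) 4 := by
    have h := runs_pour (a := iA) (b := oX) (by decide) (est ρ₃ σ₄)
    rw [show (est ρ₃ σ₄ iA).length = 1 by simp [hρ₃, hρ₂]] at h
    refine h.of_eq ?_ le_rfl
    simp only [hρ₅, hρ₃, hρ₂, hρ₁, hσ₅, hσ₄]; simp
  have hbr : Runs (pop iA ((dropBits iA oBw iV ;; pour iV oBw) ;; emitWithX)
      ((dropBits iA oBw iV ;; pour iV oBw) ;; clear oX ;; pour iA oX) skip) (est ρ₁ σ) (est ρ₅ σ₅)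
      (5 * b + 1 + (3 * b + 1) + (3 + 4) + 2) :=
    Runs.pop_false _ _ (w := natToWord b v ++ [S.sym v]) (by simp [hρ₁, tRec]) ((h2.seq h3).seq (h4.seq h5))
  refine (h1.seq hbr).of_eq ?_ (by unfold joinBound; omega)
  simp only [hρ₅, hρ₃, hρ₂, hρ₁, hσ₅, hσ₄, hσ₃, hA, hV]
  obtain ⟨⟩ := σ; simp only at hBw ⊢; simp [hBw]

/-- Effect of `joinBody` on a cube record. [folklore] -/
theorem runs_joinBody_gRec (S : SymPlus n) {b : ℕ} (T : ℕ) (rest : List Bool) (x : Bool) (ρ : RRF) (σ : YRF)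
    (hL : ρ.L = dbl (gRec S b T) ++ false :: true :: rest) (hA : ρ.A = []) (hw : ρ.w = []) (ht : ρ.t = [])
    (hV : ρ.V = []) (hBw : σ.Bw = List.replicate b true) (hX : σ.X = [x]) :
    Runs joinBody (est ρ σ)
      (est { ρ with L := rest, z := true :: false :: ((dbl (natToWord n T ++ [x])).reverse ++ ρ.z) } σ)
      (joinBound n b) := by
  set ρ₁ : RRF := { ρ with L := rest, A := gRec S b T } with hρ₁
  have h1 : Runs (readItemTo iL iA iw it) (est ρ σ) (est ρ₁ σ) (11 * (b + n + 1) + 9) := by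
    have h := runs_readItemTo (L := iL) (A := iA) (w := iw) (t := it) (by decide) (by decide) (by decide)
      (by decide) (by decide) (gRec S b T) rest (est ρ σ) (by simp [hL]) (by simp [hw]) (by simp [ht])
    rw [show (gRec S b T).length = b + n + 1 by simp [gRec, Nat.add_comm]] at h
    refine h.of_eq ?_ le_rfl
    simp only [hρ₁]; simp [hA]
  set ρ₂ : RRF := { ρ₁ with A := natToWord n T, V := List.replicate b true } with hρ₂
  set σ₂ : YRF := { σ with Bw := [] } with hσ₂
  have h2 : Runs (dropBits iA oBw iV) (Function.update (est ρ₁ σ) iA (natToWord b (gVal S T) ++ natToWord n T))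
      (est ρ₂ σ₂) (5 * b + 1) := by
    have h := runs_dropBits (A := iA) (U := oBw) (V := iV) (by decide) (by decide) (by decide) b
      (Function.update (est ρ₁ σ) iA (natToWord b (gVal S T) ++ natToWord n T)) (by simp [hBw])
    refine h.of_eq ?_ le_rfl
    simp only [hρ₂, hρ₁, hσ₂]; simp [hV]
  set σ₃ : YRF := { σ with Bw := List.replicate b true } with hσ₃
  set ρ₃ : RRF := { ρ₂ with V := [] } with hρ₃
  have h3 : Runs (pour iV oBw) (est ρ₂ σ₂) (est ρ₃ σ₃) (3 * b + 1) := by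
    have h := runs_pour (a := iV) (b := oBw) (by decide) (est ρ₂ σ₂)
    rw [show (est ρ₂ σ₂ iV).length = b by simp [hρ₂]] at h
    refine h.of_eq ?_ le_rfl
    simp only [hρ₃, hρ₂, hσ₃, hσ₂]; simp
  -- emit the point, then the bit on `X`, then the separator
  set ρ₄ : RRF := { ρ₃ with A := [], z := (dbl (natToWord n T)).reverse ++ ρ.z } with hρ₄
  have h4 : Runs (emitPart iA iz) (est ρ₃ σ₃) (est ρ₄ σ₃) (4 * n + 1) := by
    have h := runs_emitPart (h := iA) (o := iz) (by decide) (est ρ₃ σ₃)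
    rw [show (est ρ₃ σ₃ iA).length = n by simp [hρ₃, hρ₂]] at h
    refine h.of_eq ?_ le_rfl
    simp only [hρ₄, hρ₃, hρ₂, hρ₁]; simp
  set ρ₅ : RRF := { ρ₄ with z := x :: x :: ((dbl (natToWord n T)).reverse ++ ρ.z) } with hρ₅
  have h5 : Runs (pop oX (push oX true ;; push iz true ;; push iz true) (push oX false ;; push iz false ;; push iz false)
      (push iz false ;; push iz false)) (est ρ₄ σ₃) (est ρ₅ σ₃) 5 := by
    cases x with
    | true =>
      refine (Runs.pop_true _ _ (w := []) (by simp [hσ₃, hX]) ((Runs.push oX true _).seq ((Runs.push iz true _).seq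
        (Runs.push iz true _)))).of_eq ?_ (by rfl)
      simp only [hρ₅, hρ₄, hσ₃]; obtain ⟨⟩ := σ; simp only at hX hBw ⊢; simp [hX]
    | false =>
      refine (Runs.pop_false _ _ (w := []) (by simp [hσ₃, hX]) ((Runs.push oX false _).seq ((Runs.push iz false _).seq
        (Runs.push iz false _)))).of_eq ?_ (by rfl)
      simp only [hρ₅, hρ₄, hσ₃]; obtain ⟨⟩ := σ; simp only at hX hBw ⊢; simp [hX]
  set ρ₆ : RRF := { ρ₅ with z := true :: false :: (x :: x :: ((dbl (natToWord n T)).reverse ++ ρ.z)) } with hρ₆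
  have h6 : Runs (emitSep iz) (est ρ₅ σ₃) (est ρ₆ σ₃) 2 := (runs_emitSep iz _).of_eq (by simp only [hρ₆, hρ₅]; simp) le_rfl
  have hbr : Runs (pop iA ((dropBits iA oBw iV ;; pour iV oBw) ;; emitWithX)
      ((dropBits iA oBw iV ;; pour iV oBw) ;; clear oX ;; pour iA oX) skip) (est ρ₁ σ) (est ρ₆ σ₃)
      (5 * b + 1 + (3 * b + 1) + (4 * n + 1 + (5 + 2)) + 2) :=
    Runs.pop_true _ _ (w := natToWord b (gVal S T) ++ natToWord n T) (by simp [hρ₁, gRec])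
      ((h2.seq h3).seq (h4.seq (h5.seq h6)))
  refine (h1.seq hbr).of_eq ?_ (by unfold joinBound; omega)
  simp only [hρ₆, hρ₅, hρ₄, hρ₃, hρ₂, hρ₁, hσ₃, hA, hV]
  obtain ⟨⟩ := σ; simp only at hBw ⊢; simp [hBw, dbl, List.reverse_append]

/-- **The join pass** over a list of gate and cube records: the emitted records and the final
bit are those of the model `joinFold`. [folklore] -/
theorem runs_joinPass (S : SymPlus n) (b : ℕ) (full : List (List Bool))
    (hform : ∀ w ∈ full, (∃ v, w = tRec S b v) ∨ (∃ T, w = gRec S b T)) (x₀ : Bool) (ρ : RRF) (σ : YRF)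
    (hL : ρ.L = encList full) (hA : ρ.A = []) (hz : ρ.z = []) (hw : ρ.w = []) (ht : ρ.t = []) (hV : ρ.V = [])
    (hBw : σ.Bw = List.replicate b true) (hX : σ.X = [x₀]) :
    Runs (streamLoop iL iw joinBody) (est ρ σ)
      (est { ρ with L := [], z := outRev (joinFold b full (x₀, [])).2 } { σ with X := [(joinFold b full (x₀, [])).1] })
      ((full.map fun _ => joinBound n b).sum + 6 * full.length + 4) := by
  let P : List (List Bool) → Regs YReg → Prop := fun l R => ∃ done, full = done ++ l ∧
    R = est { ρ with L := encList l, z := outRev (joinFold b done (x₀, [])).2 } { σ with X := [(joinFold b done (x₀, [])).1] }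
  have hbody : ∀ (a : List Bool) (l : List (List Bool)) (R : Regs YReg), P (a :: l) R →
      R iL = encList (a :: l) → R iw = [] → ∃ R', Runs joinBody R R' (joinBound n b) ∧
        R' iL = encList l ∧ R' iw = [] ∧ P l R' := by
    rintro a l R ⟨done, hdone, rfl⟩ - -
    have hstep : ∀ w, joinFold b (done ++ [w]) (x₀, []) = joinStep b (joinFold b done (x₀, [])) w := fun w => by
      simp [joinFold, List.foldl_append]
    rcases hform a (by rw [hdone]; simp) with ⟨v, rfl⟩ | ⟨T, rfl⟩
    · refine ⟨_, runs_joinBody_tRec S (b := b) v (encList l) (joinFold b done (x₀, [])).1 _ _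
        (by simp [encList_cons_eq_dbl]) (by simp [hA]) (by simp [hw]) (by simp [ht]) (by simp [hV]) (by simp [hBw]) (by simp),
        by simp, by simp [hw], done ++ [tRec S b v], by simp [hdone], ?_⟩
      rw [hstep]; simp [joinStep, tRec]
    · refine ⟨_, runs_joinBody_gRec S (b := b) T (encList l) (joinFold b done (x₀, [])).1 _ _
        (by simp [encList_cons_eq_dbl]) (by simp [hA]) (by simp [hw]) (by simp [ht]) (by simp [hV]) (by simp [hBw]) (by simp),
        by simp, by simp [hw], done ++ [gRec S b T], by simp [hdone], ?_⟩
      rw [hstep]; simp [joinStep, gRec, outRev_append, dbl]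
  obtain ⟨R', hloop, -, -, ⟨done, hdone, rfl⟩⟩ := runs_streamLoop (L := iL) (w := iw) (by decide) encList rfl
    encList_cons_ne_nil P (fun _ => joinBound n b) hbody full (est ρ σ)
    ⟨[], by simp, by obtain ⟨⟩ := ρ; obtain ⟨⟩ := σ; simp only at hL hz hX ⊢; simp [hL, hz, hX, joinFold]⟩
    (by simp [hL]) (by simp [hw])
  rw [List.append_nil] at hdone
  subst hdone
  exact hloop.of_eq (by simp) le_rfl

/-- The records of the first sort are gate or cube records. [folklore] -/
theorem recSorted_form (S : SymPlus n) (b : ℕ) :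
    ∀ w ∈ recSorted S b, (∃ v, w = tRec S b v) ∨ (∃ T, w = gRec S b T) := by
  intro w hw
  simp only [recSorted, List.mem_flatMap, List.mem_cons, List.mem_map] at hw
  obtain ⟨v, -, rfl | ⟨T, -, rfl⟩⟩ := hw
  · exact Or.inl ⟨v, rfl⟩
  · exact Or.inr ⟨T, rfl⟩

/-- The first sort keeps the number of records. [folklore] -/
theorem length_recSorted (S : SymPlus n) {b : ℕ} (hb : S.size < 2 ^ b) :
    (recSorted S b).length = 2 ^ n + (S.size + 1) := by
  rw [← radixIter_recIn S hb, length_radixIter, recIn]; simp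

/-- The joined records are the `2ⁿ` output records. [folklore] -/
theorem length_joined (S : SymPlus n) : (joined S).length = 2 ^ n := by
  rw [← length_radixIter (joined S) n, radixIter_joined]; simp

/-- `joinProg`: the cube records (zip pass), the gate records (gate pass), first sort, join pass,
second sort. [folklore] -/
def joinProg : Com YReg :=
  streamLoop iL iw zipBody ;; (fillFalse oAcc oBw oN2 ;; pour oN2 oBw) ;; streamLoop oInp iw tauBody ;; pour iz iL ;;
    (copyCount oBw iW oN2 ;; pour oN2 oBw ;; push iW true) ;; Radix.sortProg.map Sum.inl ;; clear iU ;;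
    push oX false ;; streamLoop iL iw joinBody ;; pour iz iL ;;
    (copyCount oN iW oN2 ;; pour oN2 oN) ;; Radix.sortProg.map Sum.inl ;; clear iU ;; clear oX

/-- The cost of the join phase. [folklore] -/
def joinCost (n b s : ℕ) : ℕ :=
  (2 ^ n * (15 * b + 15 * n + 37) + 6 * 2 ^ n + 4) + (4 * b + 1 + (3 * b + 1)) +
    ((s + 1) * (23 * b + 36) + 6 * (s + 1) + 4) +
    (3 * (2 ^ n * (2 * (b + n + 1) + 2) + (s + 1) * (2 * (b + 2) + 2)) + 1) +
    (4 * b + 1 + (3 * b + 1) + 1) +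
    ((b + 1) * (2 ^ n * (21 * (b + n + 1) + 12 * (b + 1) + 30) + (s + 1) * (21 * (b + 2) + 12 * (b + 1) + 30) + 6 + 3) + 1) +
    (2 * (b + 1) + 1) + 1 +
    ((2 ^ n + (s + 1)) * joinBound n b + 6 * (2 ^ n + (s + 1)) + 4) +
    (3 * (2 ^ n * (2 * (n + 1) + 2)) + 1) +
    (4 * n + 1 + (3 * n + 1)) + (n * (2 ^ n * (21 * (n + 1) + 12 * n + 30) + 6 + 3) + 1) + (2 * n + 1) + 3

/-- The table items are the items of the values `0, …, s`. [folklore] -/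
theorem tableItems_eq (S : SymPlus n) : tableItems S = (List.range (S.size + 1)).map (tItem S) := rfl

/-- The length of the reversed code of a list of words of known lengths. [folklore] -/
theorem length_outRev_map_const {α : Type} (l : List α) (f : α → List Bool) (k : ℕ) (h : ∀ a ∈ l, (f a).length = k) :
    (outRev (l.map f)).length = l.length * (2 * k + 2) := by
  rw [Radix.length_outRev, List.map_map, List.map_congr_left (fun a ha => by simp [h a ha] :
    ∀ a ∈ l, ((fun v : List Bool => 2 * v.length + 2) ∘ f) a = 2 * k + 2), List.map_const', List.sum_replicate,
    smul_eq_mul]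

/-- `passCost` on words of one length. [folklore] -/
theorem passCost_map_const {α : Type} (i : ℕ) (l : List α) (f : α → List Bool) (k : ℕ) (h : ∀ a ∈ l, (f a).length = k) :
    Radix.passCost i (l.map f) = l.length * (21 * k + 12 * i + 30) + 6 := by
  unfold Radix.passCost
  rw [List.map_map, List.map_congr_left (fun a ha => by simp [h a ha] :
    ∀ a ∈ l, ((fun v : List Bool => 21 * v.length + 12 * i + 30) ∘ f) a = 21 * k + 12 * i + 30), List.map_const',
    List.sum_replicate, smul_eq_mul]

/-- **Effect of the join phase** (`s < 2ᵇ`): from the final table on `L`, the enumeration on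
`Ek` and the table items on `inp`, the output records `outRec S T` (the point, then its
truth-table bit), `T < 2ⁿ` in increasing order, end up on `L`. [folklore] -/
theorem runs_joinProg (S : SymPlus n) {b : ℕ} (hb : S.size < 2 ^ b) (ρ : RRF) (σ : YRF)
    (hL : ρ.L = encList ((gTable S n).map (natToWord b))) (hA : ρ.A = []) (hz : ρ.z = []) (ho : ρ.o = [])
    (hw : ρ.w = []) (ht : ρ.t = []) (hU : ρ.U = []) (hV : ρ.V = []) (hp : ρ.p = []) (hW : ρ.W = [])
    (hEk : σ.Ek = encList (enumWords n)) (hinp : σ.inp = encList (tableItems S)) (hacc : σ.acc = [])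
    (hBw : σ.Bw = List.replicate b true) (hN : σ.N = List.replicate n true) (hN2 : σ.N2 = []) (hC : σ.C = [])
    (hX : σ.X = []) :
    Runs joinProg (est ρ σ)
      (est { ρ with L := encList ((List.range (2 ^ n)).map (outRec S)) }
        { σ with Ek := [], inp := [], acc := natToWord b (S.size + 1) }) (joinCost n b S.size) := by
  have hGT : (gTable S n).map (natToWord b) = (List.range (2 ^ n)).map (gw S b) := by
    rw [gTable_n_eq_map, List.map_map]; rfl
  -- 1. cube records
  set ρ₁ : RRF := { ρ with L := [], z := outRev ((List.range (2 ^ n)).map (gRec S b)) } with hρ₁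
  set σ₁ : YRF := { σ with Ek := [] } with hσ₁
  have h1 : Runs (streamLoop iL iw zipBody) (est ρ σ) (est ρ₁ σ₁) (2 ^ n * (15 * b + 15 * n + 37) + 6 * 2 ^ n + 4) := by
    have h := runs_zipPass S b (List.range (2 ^ n)) ρ σ (by rw [hL, hGT]) (by rw [hEk]; rfl) hA hz hw ht hC
    simp only [List.map_const', List.sum_replicate, smul_eq_mul, List.length_range] at h
    exact h.of_eq (by simp only [hρ₁, hσ₁]) le_rfl
  -- 2. the counter at zero
  set σ₂ : YRF := { σ₁ with acc := natToWord b 0 } with hσ₂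
  have h2 : Runs (fillFalse oAcc oBw oN2 ;; pour oN2 oBw) (est ρ₁ σ₁) (est ρ₁ σ₂) (4 * b + 1 + (3 * b + 1)) := by
    have e1 := runs_fillFalse (A := oAcc) (U := oBw) (V := oN2) (by decide) (by decide) (by decide) b
      (est ρ₁ σ₁) (by simp [hσ₁, hBw])
    set σ' : YRF := { σ₁ with acc := List.replicate b false, Bw := [], N2 := List.replicate b true } with hσ'
    have e1' : Runs (fillFalse oAcc oBw oN2) (est ρ₁ σ₁) (est ρ₁ σ') (4 * b + 1) := by
      refine e1.of_eq ?_ le_rfl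
      simp only [hσ', hσ₁]; simp [hacc, hN2]
    have e2 := runs_pour (a := oN2) (b := oBw) (by decide) (est ρ₁ σ')
    rw [show (est ρ₁ σ' oN2).length = b by simp [hσ']] at e2
    refine (e1'.seq e2).of_eq ?_ le_rfl
    simp only [hσ₂, hσ', hσ₁, natToWord_zero]; simp [hBw, hN2]
  -- 3. gate records
  set ρ₃ : RRF := { ρ₁ with z := outRev (recIn S b) } with hρ₃
  set σ₃ : YRF := { σ₂ with inp := [], acc := natToWord b (S.size + 1) } with hσ₃
  have h3 : Runs (streamLoop oInp iw tauBody) (est ρ₁ σ₂) (est ρ₃ σ₃)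
      ((S.size + 1) * (23 * b + 36) + 6 * (S.size + 1) + 4) := by
    have h := runs_tauPass S b (List.range (S.size + 1)) 0 ((List.range (2 ^ n)).map (gRec S b)) ρ₁ σ₂ (by simp)
      (by simp [hσ₂, hσ₁, hinp, tableItems_eq]) (by simp [hσ₂]) (by simp [hρ₁, hA]) (by simp [hρ₁]) (by simp [hρ₁, hw])
      (by simp [hρ₁, ht]) (by simp [hρ₁, hp]) (by simp [hσ₂, hσ₁, hC])
    simp only [List.map_const', List.sum_replicate, smul_eq_mul, List.length_range, Nat.zero_add] at h
    exact h.of_eq (by simp only [hρ₃, hσ₃, hρ₁, recIn]) le_rfl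
  -- 4. the records onto `L`
  set ρ₄ : RRF := { ρ with L := encList (recIn S b) } with hρ₄
  have h4 : Runs (pour iz iL) (est ρ₃ σ₃) (est ρ₄ σ₃)
      (3 * (2 ^ n * (2 * (b + n + 1) + 2) + (S.size + 1) * (2 * (b + 2) + 2)) + 1) := by
    have h := runs_pour (a := iz) (b := iL) (by decide) (est ρ₃ σ₃)
    have hlen : (est ρ₃ σ₃ iz).length = 2 ^ n * (2 * (b + n + 1) + 2) + (S.size + 1) * (2 * (b + 2) + 2) := by
      simp only [Sum.elim_inl, regs_z, hρ₃, recIn]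
      rw [Radix.length_outRev, List.map_append, List.sum_append, ← Radix.length_outRev, ← Radix.length_outRev,
        length_outRev_map_const _ _ (b + n + 1) (fun T _ => by
          simp only [gRec, List.length_cons, List.length_append, length_natToWord, Nat.add_comm]),
        length_outRev_map_const _ _ (b + 2) (fun v _ => by simp [tRec]), List.length_range, List.length_range]
    rw [hlen] at h
    refine h.of_eq ?_ le_rfl
    simp only [hρ₄, hρ₃, hρ₁]; simp [reverse_outRev, hz]
  -- 5.–7. first sort
  set ρ₅ : RRF := { ρ₄ with W := List.replicate (b + 1) true } with hρ₅
  have h5 : Runs (copyCount oBw iW oN2 ;; pour oN2 oBw ;; push iW true) (est ρ₄ σ₃) (est ρ₅ σ₃) (4 * b + 1 + (3 * b + 1) + 1) := by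
    have e1 := runs_copyCount (U := oBw) (A := iW) (V := oN2) (by decide) (by decide) (by decide) b (est ρ₄ σ₃)
      (by simp [hσ₃, hσ₂, hσ₁, hBw])
    set σ' : YRF := { σ₃ with Bw := [], N2 := List.replicate b true } with hσ'
    set ρ' : RRF := { ρ₄ with W := List.replicate b true } with hρ'
    have e1' : Runs (copyCount oBw iW oN2) (est ρ₄ σ₃) (est ρ' σ') (4 * b + 1) := by
      refine e1.of_eq ?_ le_rfl
      simp only [hσ', hσ₃, hσ₂, hσ₁, hρ', hρ₄]; simp [hW, hN2]
    have e2 := runs_pour (a := oN2) (b := oBw) (by decide) (est ρ' σ')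
    rw [show (est ρ' σ' oN2).length = b by simp [hσ']] at e2
    have e2' : Runs (pour oN2 oBw) (est ρ' σ') (est ρ' σ₃) (3 * b + 1) := by
      refine e2.of_eq ?_ le_rfl
      simp only [hσ', hσ₃, hσ₂, hσ₁]; simp [hBw, hN2]
    have e3 : Runs (push iW true) (est ρ' σ₃) (est ρ₅ σ₃) 1 := Runs.push' (by simp only [hρ₅, hρ']; simp [List.replicate_succ])
    exact (e1'.seq (e2'.seq e3)).of_eq rfl (by omega)
  set ρ₆ : RRF := { ρ₅ with L := encList (recSorted S b), U := List.replicate (b + 1) true, W := [] } with hρ₆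
  have h6 : Runs (Radix.sortProg.map Sum.inl) (est ρ₅ σ₃) (est ρ₆ σ₃)
      ((b + 1) * (2 ^ n * (21 * (b + n + 1) + 12 * (b + 1) + 30) + (S.size + 1) * (21 * (b + 2) + 12 * (b + 1) + 30) + 6 + 3) + 1) := by
    have h := runs_sort (b + 1) (recIn S b) ρ₅ σ₃ (by simp [hρ₅, hρ₄]) (by simp [hρ₅, hρ₄, hA]) (by simp [hρ₅, hρ₄, hz])
      (by simp [hρ₅, hρ₄, ho]) (by simp [hρ₅, hρ₄, hw]) (by simp [hρ₅, hρ₄, ht]) (by simp [hρ₅, hρ₄, hU])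
      (by simp [hρ₅, hρ₄, hV]) (by simp [hρ₅, hρ₄, hp]) (by simp [hρ₅])
    rw [radixIter_recIn S hb] at h
    have hpc : Radix.passCost (b + 1) (recIn S b) =
        2 ^ n * (21 * (b + n + 1) + 12 * (b + 1) + 30) + (S.size + 1) * (21 * (b + 2) + 12 * (b + 1) + 30) + 6 := by
      rw [recIn]
      unfold Radix.passCost
      rw [List.map_append, List.sum_append]
      have e1 := passCost_map_const (b + 1) (List.range (2 ^ n)) (gRec S b) (b + n + 1) (fun T _ => by
        simp only [gRec, List.length_cons, List.length_append, length_natToWord, Nat.add_comm])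
      have e2 := passCost_map_const (b + 1) (List.range (S.size + 1)) (tRec S b) (b + 2) (fun v _ => by simp [tRec])
      unfold Radix.passCost at e1 e2
      simp only [List.length_range] at e1 e2
      omega
    rw [hpc] at h
    exact h.of_eq (by simp only [hρ₆]) le_rfl
  set ρ₇ : RRF := { ρ₆ with U := [] } with hρ₇
  have h7 : Runs (clear iU) (est ρ₆ σ₃) (est ρ₇ σ₃) (2 * (b + 1) + 1) := by
    have h := runs_clear iU (est ρ₆ σ₃)
    rw [show (est ρ₆ σ₃ iU).length = b + 1 by simp [hρ₆]] at h
    exact h.of_eq (by simp only [hρ₇, update_est_inl, update_U]) le_rfl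
  -- 8.–10. join pass
  set σ₈ : YRF := { σ₃ with X := [false] } with hσ₈
  have h8 : Runs (push oX false) (est ρ₇ σ₃) (est ρ₇ σ₈) 1 := Runs.push' (by simp only [hσ₈, hσ₃, hσ₂, hσ₁]; simp [hX])
  set ρ₉ : RRF := { ρ₇ with L := [], z := outRev (joined S) } with hρ₉
  set σ₉ : YRF := { σ₈ with X := [(joinFold b (recSorted S b) (false, [])).1] } with hσ₉
  have h9 : Runs (streamLoop iL iw joinBody) (est ρ₇ σ₈) (est ρ₉ σ₉)
      ((2 ^ n + (S.size + 1)) * joinBound n b + 6 * (2 ^ n + (S.size + 1)) + 4) := by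
    have h := runs_joinPass S b (recSorted S b) (recSorted_form S b) false ρ₇ σ₈ (by simp [hρ₇, hρ₆])
      (by simp [hρ₇, hρ₆, hρ₅, hρ₄, hA]) (by simp [hρ₇, hρ₆, hρ₅, hρ₄, hz]) (by simp [hρ₇, hρ₆, hρ₅, hρ₄, hw])
      (by simp [hρ₇, hρ₆, hρ₅, hρ₄, ht]) (by simp [hρ₇, hρ₆, hρ₅, hρ₄, hV]) (by simp [hσ₈, hσ₃, hσ₂, hσ₁, hBw]) (by simp [hσ₈])
    rw [joinFold_recSorted] at h
    simp only [List.map_const', List.sum_replicate, smul_eq_mul, length_recSorted S hb] at h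
    exact h.of_eq (by simp only [hρ₉, hσ₉, joined]) le_rfl
  set ρ₁₀ : RRF := { ρ with L := encList (joined S) } with hρ₁₀
  have h10 : Runs (pour iz iL) (est ρ₉ σ₉) (est ρ₁₀ σ₉) (3 * (2 ^ n * (2 * (n + 1) + 2)) + 1) := by
    have h := runs_pour (a := iz) (b := iL) (by decide) (est ρ₉ σ₉)
    have hlen : (est ρ₉ σ₉ iz).length = 2 ^ n * (2 * (n + 1) + 2) := by
      simp only [Sum.elim_inl, regs_z, hρ₉]
      have hperm : (joined S).Perm ((List.range (2 ^ n)).map (outRec S)) := by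
        rw [← radixIter_joined S]; exact (radixIter_perm _ _).symm
      rw [Radix.length_outRev, (hperm.map _).sum_eq, ← Radix.length_outRev,
        length_outRev_map_const _ _ (n + 1) (fun T _ => by simp [outRec]), List.length_range]
    rw [hlen] at h
    refine h.of_eq ?_ le_rfl
    simp only [hρ₁₀, hρ₉, hρ₇, hρ₆, hρ₅, hρ₄]; simp [reverse_outRev, hz, hU, hW]
  -- 11.–14. second sort, clean up
  set ρ₁₁ : RRF := { ρ₁₀ with W := List.replicate n true } with hρ₁₁
  have h11 : Runs (copyCount oN iW oN2 ;; pour oN2 oN) (est ρ₁₀ σ₉) (est ρ₁₁ σ₉) (4 * n + 1 + (3 * n + 1)) := by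
    have e1 := runs_copyCount (U := oN) (A := iW) (V := oN2) (by decide) (by decide) (by decide) n (est ρ₁₀ σ₉)
      (by simp [hσ₉, hσ₈, hσ₃, hσ₂, hσ₁, hN])
    set σ' : YRF := { σ₉ with N := [], N2 := List.replicate n true } with hσ'
    have e1' : Runs (copyCount oN iW oN2) (est ρ₁₀ σ₉) (est ρ₁₁ σ') (4 * n + 1) := by
      refine e1.of_eq ?_ le_rfl
      simp only [hσ', hσ₉, hσ₈, hσ₃, hσ₂, hσ₁, hρ₁₁, hρ₁₀]; simp [hW, hN2]
    have e2 := runs_pour (a := oN2) (b := oN) (by decide) (est ρ₁₁ σ')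
    rw [show (est ρ₁₁ σ' oN2).length = n by simp [hσ']] at e2
    refine (e1'.seq e2).of_eq ?_ le_rfl
    simp only [hσ', hσ₉, hσ₈, hσ₃, hσ₂, hσ₁]; simp [hN, hN2]
  set ρ₁₂ : RRF := { ρ₁₁ with L := encList ((List.range (2 ^ n)).map (outRec S)), U := List.replicate n true, W := [] } with hρ₁₂
  have h12 : Runs (Radix.sortProg.map Sum.inl) (est ρ₁₁ σ₉) (est ρ₁₂ σ₉)
      (n * (2 ^ n * (21 * (n + 1) + 12 * n + 30) + 6 + 3) + 1) := by
    have h := runs_sort n (joined S) ρ₁₁ σ₉ (by simp [hρ₁₁, hρ₁₀]) (by simp [hρ₁₁, hρ₁₀, hA]) (by simp [hρ₁₁, hρ₁₀, hz])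
      (by simp [hρ₁₁, hρ₁₀, ho]) (by simp [hρ₁₁, hρ₁₀, hw]) (by simp [hρ₁₁, hρ₁₀, ht]) (by simp [hρ₁₁, hρ₁₀, hU])
      (by simp [hρ₁₁, hρ₁₀, hV]) (by simp [hρ₁₁, hρ₁₀, hp]) (by simp [hρ₁₁])
    rw [radixIter_joined] at h
    have hpc : Radix.passCost n (joined S) = 2 ^ n * (21 * (n + 1) + 12 * n + 30) + 6 := by
      have hperm : (joined S).Perm ((List.range (2 ^ n)).map (outRec S)) := by
        rw [← radixIter_joined S]; exact (radixIter_perm _ _).symm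
      rw [Radix.passCost_perm hperm, passCost_map_const n _ _ (n + 1) (fun T _ => by simp [outRec]), List.length_range]
    rw [hpc] at h
    exact h.of_eq (by simp only [hρ₁₂]) le_rfl
  set ρ₁₃ : RRF := { ρ₁₂ with U := [] } with hρ₁₃
  have h13 : Runs (clear iU) (est ρ₁₂ σ₉) (est ρ₁₃ σ₉) (2 * n + 1) := by
    have h := runs_clear iU (est ρ₁₂ σ₉)
    rw [show (est ρ₁₂ σ₉ iU).length = n by simp [hρ₁₂]] at h
    exact h.of_eq (by simp only [hρ₁₃, update_est_inl, update_U]) le_rfl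
  have h14 : Runs (clear oX) (est ρ₁₃ σ₉) (est ρ₁₃ σ₃) 3 := by
    have h := runs_clear oX (est ρ₁₃ σ₉)
    rw [show (est ρ₁₃ σ₉ oX).length = 1 by simp [hσ₉]] at h
    refine h.of_eq ?_ le_rfl
    simp only [hσ₉, hσ₈, hσ₃, hσ₂, hσ₁]; obtain ⟨⟩ := σ; simp only at hX ⊢; simp [hX]
  have H := h1.seq (h2.seq (h3.seq (h4.seq (h5.seq (h6.seq (h7.seq (h8.seq (h9.seq (h10.seq (h11.seq (h12.seq (h13.seq h14))))))))))))
  refine H.of_eq ?_ (by unfold joinCost; omega)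
  simp only [hρ₁₃, hρ₁₂, hρ₁₁, hρ₁₀, hσ₃, hσ₂, hσ₁, hU, hW]

end YatesM

end Literature.Computability.Complexity
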